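import Summits.BirchSwinnertonDyer.Rank1Residual.SmallImageMu.EulerLossZeroChart
import Summits.BirchSwinnertonDyer.Rank1Residual.SmallImageMu.MuLeFineMu
import Summits.BirchSwinnertonDyer.Rank1Residual.SmallImageMu.EulerPrimitive
import HarnessLib
import HarnessLib.Audit

/-!
# Kernel glue of ES-C7 (`EulerLossZeroOnClassX9`), part 2 — class level: (c7a) 19630 ⟹ ES-C7 with NO
# named fact; (c7b) ES-C7 ∧ ES-C6 ⟹ 19630; (c7↔) 19630 ⟺ ES-C7 ∧ ES-C6 (mod F1, modularity);
# (c7c) ES-C7 ⟹ ES-C2 (mod F1_ζ, Kato Thm. 12.4, modularity) — theorems only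

HONEST FRAMING (cell `bsd-f3-mu`).  THEOREMS ONLY, sorry-free; CONDITIONAL, credits nothing; every
statement is conditional on the open nodes in its hypotheses and/or on PUBLISHED named facts taken as
binders (`hfine` = F1 `Kato2004.exists_divisibilityInputs_fineQuotient`; `hfineζ` = its span-clause form
`Kato2004.exists_divisibilityInputs_fineQuotient_zeta`; `h12` = `Kato2004.thm12_4`; `hmodP` =
`nonempty_modularParametrizationData`; `hμ`/`hA` = item 19630 `AnalyticMuZeroOnClassX9`; `h6` = ES-C6
`MuLeFineMuOnClassX9`; `h7` = ES-C7 `EulerLossZeroOnClassX9`).  Ported from `HOME/es/EulerLossChartExact.lean`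
§5 («Sketch7», sha16 4b5b6c8384c6f496; -ref1 SURVIVES, -ref2 row es-§27) over the per-pair chart of
`EulerLossZeroChart.lean`; edge (c7c) is the typer's kernel check of the CANDIDATES row-26 claim «ES-C7 ⟹
ES-C2 given `𝐇¹ ≅ Λ` + span clause».

* (c7a) `eulerLossZeroOnClassX9_of_analyticMuZero : AnalyticMuZeroOnClassX9 → EulerLossZeroOnClassX9` —
  UNCONDITIONAL (the census witness: every certified X9 row satisfies ES-C7);
* (c7b) `analyticMuZeroOnClassX9_of_eulerLossZero_of_muLeFineMu` (mod F1, modularity);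
* (c7↔) `analyticMuZeroOnClassX9_iff_eulerLossZero_and_muLeFineMu` — on X9 the cell's analytic target
  (Greenberg Conj. 1.11, analytic side) is EXACTLY ES-C7 ∧ ES-C6 (mod F1, modularity);
* (c7c) `eulerPrimitiveOnClassX9_of_eulerLossZero : thm12_4 → hmodP → F1_ζ → ES-C7 → ES-C2`.
PARTITION: closes no class (X9 790 = 130 + 36 + 624; X10b 610 + 273); beyond-print theorem: NO.

References: [Kato2004Asterisque] Thm. 12.4 (p. 221), Thm. 12.6 (p. 222), Thm. 17.4 (p. 273), §17.13
(pp. 279–280); [GreenbergLNM1716] Conj. 1.11; HOME MEMO-es.md §27, es/EulerLossChartExact.lean §5,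
CANDIDATES.md §1 row 26.
-/

-- the summit and its single problem are both named `BirchSwinnertonDyer` (registry layout D-0017)
set_option linter.dupNamespace false

noncomputable section

open scoped Classical MatrixGroups ModularForm NumberField
open CongruenceSubgroup WeierstrassCurve Field
open Literature.NumberTheory.GaloisRepresentations
open Literature.NumberTheory.EllipticCurves Literature.NumberTheory.EllipticCurves.ModularForms
open Literature.NumberTheory.EllipticCurves.Kato2004
open Literature.NumberTheory.EllipticCurves.Kato2004.EulerSystemValues
open Literature.NumberTheory.EllipticCurves.IwasawaDual
-- only the carriers from the Literature residual namespace (its census `ClassX9` must not shadow the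
-- `μ`-version `Rank1ResidualX9Defs.ClassX9` used by the SmallImageMu nodes)
open Literature.NumberTheory.EllipticCurves.Rank1Residual (MuAnZeroAt MuAlgZeroAt FineMuZeroAt
  MuDefectNonposAt KatoDivisibilityAt MuLeFineMuAt EulerLossZeroAt)
open Summit.BirchSwinnertonDyer.BirchSwinnertonDyer.Rank1Residual (ClassX9 AnalyticMuZeroOnClassX9)
open Module IwasawaAlgebra

namespace Summit.BirchSwinnertonDyer.Rank1Residual.SmallImageMu

/-! ## §3 Class level: the node ES-C7 against 19630, ES-C6 and ES-C2 -/

section Node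

/-- **(c7a) item 19630 (`AnalyticMuZeroOnClassX9`) ⟹ ES-C7, UNCONDITIONALLY** (no F1, no BCS, no
modularity fact: the node quantifies over newforms and packages, and cotorsion comes from the package).
The census witness: every certified X9 row (`μ^an = 0`) satisfies ES-C7.
[cite: Kato2004Asterisque, Thm. 17.4 (1) (p. 273), §17.13 (pp. 279–280)] -/
theorem eulerLossZeroOnClassX9_of_analyticMuZero (hμ : AnalyticMuZeroOnClassX9) :
    EulerLossZeroOnClassX9 := by
  intro W _ _ p _ _ hX9
  obtain ⟨-, hp5, hgood, hap, hirr, -⟩ := id hX9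
  have hp2 : p ≠ 2 := by omega
  have hμ' : MuAnZeroAt W p := by
    intro N _ f hf
    exact hμ W p f hX9 hf
  exact eulerLossZeroAt_of_muAnZeroAt hμ' hp2 ⟨hgood, hap⟩ hirr

/-- **(c7b) ES-C7 ∧ ES-C6 ⟹ item 19630 (`μ^an = 0` on X9)** (mod F1 and a modularity witness): the two
ES-lens nodes JOINTLY recover the cell's analytic target on X9.
[cite: Kato2004Asterisque, §17.13 (pp. 279–280)] -/
theorem analyticMuZeroOnClassX9_of_eulerLossZero_of_muLeFineMu
    (hfine : exists_divisibilityInputs_fineQuotient) (hmodP : nonempty_modularParametrizationData)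
    (h7 : EulerLossZeroOnClassX9) (h6 : MuLeFineMuOnClassX9) : AnalyticMuZeroOnClassX9 := by
  intro W _ _ p _ N _ f hX9 hf
  haveI : ContinuousSMul ℤ_[p] (W.tateModule p) := TateModule.continuousSMul_padicInt
  have h : MuAnZeroAt W p :=
    (muAnZeroAt_iff_eulerLossZero_and_muLeFineMu_X9 hfine hmodP hX9).mpr ⟨h7 W p hX9, h6 W p hX9⟩
  exact h f hf

/-- **(c7↔) class-level EQUIVALENCE (mod F1 and a modularity witness): `AnalyticMuZeroOnClassX9 ↔
(EulerLossZeroOnClassX9 ∧ MuLeFineMuOnClassX9)`** — the cell's analytic `μ = 0` target on X9 (Greenberg's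
Conj. 1.11, analytic side, restricted to X9) is EXACTLY the conjunction of the two ES-lens nodes ES-C7
(`δ = 0`) and ES-C6 (`e = 0`).  [cite: GreenbergLNM1716, Conj. 1.11 (p. 58)]
[cite: Kato2004Asterisque, §17.13 (pp. 279–280)] -/
theorem analyticMuZeroOnClassX9_iff_eulerLossZero_and_muLeFineMu
    (hfine : exists_divisibilityInputs_fineQuotient) (hmodP : nonempty_modularParametrizationData) :
    AnalyticMuZeroOnClassX9 ↔ EulerLossZeroOnClassX9 ∧ MuLeFineMuOnClassX9 := by
  refine ⟨fun hμ ↦ ⟨eulerLossZeroOnClassX9_of_analyticMuZero hμ, ?_⟩,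
    fun h ↦ analyticMuZeroOnClassX9_of_eulerLossZero_of_muLeFineMu hfine hmodP h.1 h.2⟩
  intro W _ _ p _ hX9
  haveI : ContinuousSMul ℤ_[p] (W.tateModule p) := TateModule.continuousSMul_padicInt
  obtain ⟨-, hp5, hgood, hap, hirr, -⟩ := id hX9
  have hp2 : p ≠ 2 := by omega
  have hμ' : MuAnZeroAt W p := by
    intro N _ f hf
    exact hμ W p f hX9 hf
  exact muLeFineMuAt_of_muAnZeroAt hfine hmodP hp2 ⟨hgood, hap⟩ hirr hμ'

/-- **(c7c) ES-C7 ⟹ ES-C2 (`EulerPrimitiveOnClassX9`)** modulo F1_ζ (the package with the Thm. 12.6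
span clause `Z ≤ span{genuine classes}`), Kato Thm. 12.4 (`𝐇¹ ≅ Λ` for `p ≠ 2`, `E[p]` irreducible) and
a modularity witness: if every genuine `Λ`-adic Euler-system class lay in `p𝐇¹`, the zeta module of the
package over the canonical data would lie in `p𝐇¹`, forcing `μ(𝐇¹/Z) ≥ 1`
(`not_zetaModule_le_augIdealP_smul_top_of_eulerLossZeroAt`).  The PACKAGE form implies the CLASS form.
[cite: Kato2004Asterisque, Thm. 12.4 (3) (p. 221), Thm. 12.6 (p. 222), §17.13 (p. 279)] -/
theorem eulerPrimitiveOnClassX9_of_eulerLossZero (h12 : thm12_4)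
    (hmodP : nonempty_modularParametrizationData)
    (hfineζ : exists_divisibilityInputs_fineQuotient_zeta) (h7 : EulerLossZeroOnClassX9) :
    EulerPrimitiveOnClassX9 := by
  intro W _ _ p _ _ _ _ κ γ I hX9 hκ hγ hγ'
  obtain ⟨-, hp5, hgood, hap, hirr, -⟩ := id hX9
  have hp2 : p ≠ 2 := by omega
  have hord : IsOrdinaryAt W p := ⟨hgood, hap⟩
  haveI : NeZero (W.conductorNorm ℤ) := ⟨(W.conductorNorm_pos_holds).ne'⟩
  obtain ⟨Dm⟩ := hmodP W
  let D : W.SelmerDualData κ γ := W.selmerDualData κ hγ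
  obtain ⟨Y⟩ := W.nonempty_fineSelmerDualData κ hγ
  obtain ⟨K, π, -, -, hZ⟩ := hfineζ W p Dm.f κ γ hp2 hord hκ hγ hγ' Dm.isNewformOf I D Y
  have hL : padicLFunction Dm.f (unitRoot W p : ℚ_[p]) ≠ 0 :=
    padicLFunction_unitRoot_ne_zero hord Dm.isNewformOf
  obtain ⟨hfin, -, h3⟩ := h12 W p κ γ hκ hγ I
  obtain ⟨hfree, hrank⟩ := h3 hp2 hirr
  haveI := hfin
  haveI := hfree
  by_contra hall
  push Not at hall
  have hZ1 : K.Z ≤ augIdealP p • (⊤ : Submodule (IwasawaAlgebra p) I.H) :=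
    hZ.trans (Submodule.span_le.mpr fun s hs ↦ hall s hs)
  exact not_zetaModule_le_augIdealP_smul_top_of_eulerLossZeroAt (h7 W p hX9) hκ hγ hγ' Dm.isNewformOf hL
    hrank K hZ1

end Node

end Summit.BirchSwinnertonDyer.Rank1Residual.SmallImageMu

end
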